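import Literature.MathematicalPhysics.QuantumFieldTheory.Balaban1983to89.B13JointWalkExpansion

/-!
# `Balaban1983to89.B13LocalKernelWalks` — [Balaban1985BackgroundPropagators] Thm 3.10 p. 416 (3.107)–(3.108) at walk
length `|ω| ≤ 1` with [Balaban1988RG2Cluster] (1.11) p. 5 ∕ p. 13 (the s-monomial of a term): ONE-STEP LOCAL KERNEL
FAMILIES on the unit torus ARE `JointWalkExpansion`s, with constants INDEPENDENT OF THE TORUS

statement-level skeleton of published theorems with citation tags; proofs where landed; no claim about the Yang–Mills mass gap

CITATION HEADER.  [B9] = T. Bałaban, CMP **99** (1985) 389–434, Thm 3.10 p. 416 (verbatim in `B13JointWalkExpansion`):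
*"A term in this expansion, corresponding to a walk ω, depends on configuration U restricted to X̃₀⁵ ∪ … ∪ X̃ₙ⁵, satisfies the
inequality … e^{−½δ₀d(ω,y,y′)} … The constant O(1) depends on d and L only."*; [B6] = CMP **96** (1984) Lemma 2.1 (2.61)
p. 234 (the row sum, `B11SectG.RowSum`, on the one-scale torus `B9Thm37GlueTorus.h261_torusGeom` ∕ `torusSum_tdist1_le`);
[II] = CMP **116** (1988) (1.11) p. 5 *"m is the number of the parameters s connected with the walk ω"*, p. 13.

WHAT THIS FILE PROVES (cell `pub-balaban-gaps`, row (D4) NODE O, seat g1-p2 gen 4; the BASE CASE of the walk calculus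
whose product ∕ Neumann steps are ne5's `Spine/NE5/ProductWalks` and [B9] (3.130)).  `LocalTerms`: finitely many one-step
terms `b` = entry pattern `M_b` on ONE located pair `(x_b,y_b)` at ℓ¹-distance `≤ r` × coefficient `c_b(u)` analytic and
`≤ λ` on the `R`-ball × s-monomial `∏_{j∈J_b} σ_j` (`|J_b| ≤ m_J`), σ-carrying terms touching `X`, `≤ n_B` terms per start
site (`IsLocal`).  `jointWalkExpansion_local`: `K(σ,u) = Σ_b T_b(σ,u)` is a `JointWalkExpansion` (`B13JointWalkExpansion`)
with σ-carrying sub-family `{J_b ≠ ∅}`, amplitudes `A = λe^{κ₁m_J}e^{ρr}`, the DETOUR distance `D_b(a,a′) = d₁(a,x_b) +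
d₁(x_b,y_b) + d₁(y_b,a′)` (dominates `d₁`, passes through `X`), any `ρ ≥ 0`, drop `ε`, rates `κ + μ ≤ ρ − ε`, constant
`K̄ = A·n_B·c_μ` (`c_μ` the (2.61) constant at rate `μ`; `rowSum_torus`: `c₀(1,μ)^ν` on EVERY torus) — NO DEPENDENCE ON
`Nf`.  Corollaries `domBy_dist`, `walkMajorants_local`; §6 a hopping family with genuine σ- and u-dependence.
HONEST FRAMING: an elementary MODEL-level lemma (finite sums, the triangle inequality, one row sum); NOTHING about
Bałaban's `Γ_k(Z₀,σ,𝐔,𝐉)`, `Δ^{(k)}`, `C^{(k)}` (multi-scale, covariant, averaged) — whether THEY admit such data with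
k-uniform constants is row (D4)'s open OBJECT-level content (GAPS G-B9-10, NODE O.2 (v)); (D4) is NOT discharged
(instance 0∕1); NOT B12 Thm 2, NOT `BetaPertH`, NOT continuum ∕ ℝ⁴, NOT infinite volume, NOT mass gap, NOT Clay.
-/

noncomputable section

namespace Literature.MathematicalPhysics.QuantumFieldTheory.Balaban1983to89.B13LocalKernelWalks

open Metric Set Finset
open Literature.MathematicalPhysics.QuantumFieldTheory.Balaban1983to89
open Literature.MathematicalPhysics.QuantumFieldTheory.Balaban1983to89.B9SectDWalk (Through MajSumLe DomBy)
open Literature.MathematicalPhysics.QuantumFieldTheory.Balaban1983to89.B9Thm34Ext (toB6)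
open Literature.MathematicalPhysics.QuantumFieldTheory.Balaban1983to89.B9Thm37GlueTorus
  (torusGeom tdist1 tdist1_nonneg tdist1_triangle tdist1_self tdist1_comm torusSum_tdist1_le)
open Literature.MathematicalPhysics.QuantumFieldTheory.Balaban1983to89.TreeLengthTorus (TPt)
open Literature.MathematicalPhysics.QuantumFieldTheory.Balaban1983to89.B5TorusCover (UT)
open Literature.MathematicalPhysics.QuantumFieldTheory.Balaban1983to89.B11SectG (RowSum)
open Literature.MathematicalPhysics.QuantumFieldTheory.Balaban1983to89.B13JointWalkExpansion
  (JointWalkExpansion WalkMajorants)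

variable {d N' : ℕ} {ν : ℕ} {Nf : Fin ν → ℕ} [∀ i, NeZero (Nf i)]
variable {p n : Type}
variable {E : Type*} [NormedAddCommGroup E] [NormedSpace ℂ E]

/-! ## §1. The datum: finitely many one-step terms with s-monomials -/

/-- **LOCAL TERM DATUM** (Type-valued record, nothing asserted): a finite index `B` of one-step terms; term `b` has a
located START `x b` and END `y b` on the site torus, a finite set `J b` of decoupling parameters it carries (print
(1.11): the monomial in the `s`-parameters *"connected with the walk"*), a coefficient `coef b : E → ℂ` (the
configuration dependence) and a fixed entry pattern `M b` (rows `p`, columns `n`).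
[cite: Balaban1988RG2Cluster, (1.11) p.5, p.13; Balaban1985BackgroundPropagators, (3.107) p.416] -/
structure LocalTerms (d N' ν : ℕ) (Nf : Fin ν → ℕ) [∀ i, NeZero (Nf i)] (p n : Type)
    (E : Type*) [NormedAddCommGroup E] [NormedSpace ℂ E] where
  B : Type
  [instFintype : Fintype B]
  x : B → UT Nf
  y : B → UT Nf
  J : B → Finset (TPt d N')
  coef : B → E → ℂ
  M : B → Matrix p n ℂ

namespace LocalTerms

/-- The term index of a datum is a finite type (the bundled instance, exposed as an instance). [folklore] -/
instance instFintypeB (L : LocalTerms d N' ν Nf p n E) : Fintype L.B := L.instFintype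
variable (L : LocalTerms d N' ν Nf p n E)

/-- The term `T_b(σ,u) = (∏_{j ∈ J_b} σ_j)·c_b(u)·M_b`. [cite: Balaban1988RG2Cluster, (1.11) p.5] -/
def term (b : L.B) : (TPt d N' → ℂ) → E → Matrix p n ℂ :=
  fun σ u => ((∏ j ∈ L.J b, σ j) * L.coef b u) • L.M b

/-- The kernel family `K(σ,u) = Σ_b T_b(σ,u)` (a finite sum). [cite: Balaban1985BackgroundPropagators, (3.107) p.416] -/
def kernel : (TPt d N' → ℂ) → E → Matrix p n ℂ :=
  fun σ u => ∑ b, L.term b σ u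

/-- The σ-CARRYING sub-family: the terms whose s-monomial is non-trivial (`m ≥ 1` in (1.11)). [cite: Balaban1988RG2Cluster, (1.11) p.5] -/
def sigmaCarrying : Set L.B := {b | (L.J b).Nonempty}

/-- The DETOUR walk distance `D_b(a,a′) = d₁(a,x_b) + d₁(x_b,y_b) + d₁(y_b,a′)` — (3.93) for the one-step walk `(x_b,y_b)`. [cite: Balaban1985BackgroundPropagators, (3.93) p.410] -/
def dist (b : L.B) : UT Nf → UT Nf → ℝ :=
  fun a a' => tdist1 Nf a (L.x b) + tdist1 Nf (L.x b) (L.y b) + tdist1 Nf (L.y b) a'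

/-- **LOCALITY of the datum** (Prop-valued, all printed features of a one-step term): entry patterns bounded by `1` and
supported on the located pair `(x_b, y_b)`; coefficients complex-differentiable and `≤ λ` on the `R`-ball ([II] p. 15);
range `d₁(x_b,y_b) ≤ r`; `|J_b| ≤ m_J`; σ-carrying terms TOUCH the σ-region `X` (p. 13); `≤ n_B` terms per start site.
[cite: Balaban1988RG2Cluster, (1.11) p.5, p.13, p.15; Balaban1985BackgroundPropagators, Thm 3.10 p.416] -/
structure IsLocal (c : B13.Consts) (locp : p → UT Nf) (locn : n → UT Nf) (X : Finset (UT Nf))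
    (R lam r : ℝ) (mJ nB : ℕ) : Prop where
  hMle : ∀ b i j, ‖L.M b i j‖ ≤ 1
  hMsupp : ∀ b i j, L.M b i j ≠ 0 → locp i = L.x b ∧ locn j = L.y b
  hcoef_an : ∀ b, DifferentiableOn ℂ (L.coef b) (ball (0 : E) R)
  hcoef_bd : ∀ b, ∀ u ∈ ball (0 : E) R, ‖L.coef b u‖ ≤ lam
  hrange : ∀ b, tdist1 Nf (L.x b) (L.y b) ≤ r
  hJ : ∀ b, (L.J b).card ≤ mJ
  hX : ∀ b, (L.J b).Nonempty → L.x b ∈ X ∨ L.y b ∈ X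
  hmult : ∀ z : UT Nf, (Finset.univ.filter fun b => L.x b = z).card ≤ nB

/-! ## §2. Elementary facts: entries of a term, the detour distance -/

/-- Entry formula of a (1.11)-shape one-step term. [cite: Balaban1988RG2Cluster, (1.11) p.5] -/
theorem term_apply (b : L.B) (σ : TPt d N' → ℂ) (u : E) (i : p) (j : n) :
    L.term b σ u i j = (∏ j ∈ L.J b, σ j) * L.coef b u * L.M b i j := by
  simp [term, Matrix.smul_apply, smul_eq_mul]

/-- Entry formula of the (3.107)-shape kernel (a finite sum of term entries). [cite: Balaban1985BackgroundPropagators, (3.107) p.416] -/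
theorem kernel_apply (σ : TPt d N' → ℂ) (u : E) (i : p) (j : n) :
    L.kernel σ u i j = ∑ b, L.term b σ u i j := by
  simp [kernel, Matrix.sum_apply]

/-- The detour distance (3.93) is non-negative. [cite: Balaban1985BackgroundPropagators, (3.93) p.410] -/
theorem dist_nonneg (b : L.B) (a a' : UT Nf) : 0 ≤ L.dist b a a' :=
  add_nonneg (add_nonneg (tdist1_nonneg _ _) (tdist1_nonneg _ _)) (tdist1_nonneg _ _)

/-- The detour distance dominates the torus distance ((2.54) twice). [cite: Balaban1984PropagatorsII, (2.54) p.233] -/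
theorem tdist1_le_dist (b : L.B) (a a' : UT Nf) : tdist1 Nf a a' ≤ L.dist b a a' := by
  have h1 := tdist1_triangle (N := Nf) a (L.y b) a'
  have h2 := tdist1_triangle (N := Nf) a (L.x b) (L.y b)
  unfold dist; linarith

/-- The detour distance (3.93) dominates the distance to the start site. [cite: Balaban1985BackgroundPropagators, (3.93) p.410] -/
theorem tdist1_start_le_dist (b : L.B) (a a' : UT Nf) : tdist1 Nf a (L.x b) ≤ L.dist b a a' := by
  have h1 := tdist1_nonneg (N := Nf) (L.x b) (L.y b)
  have h2 := tdist1_nonneg (N := Nf) (L.y b) a'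
  unfold dist; linarith

/-- `DomBy` for the detour distance, in the torus geometry of the walk objects (the hypothesis `hdom` of
`Spine/NE5/ProductWalks.walkMajorants_mul`). [cite: Balaban1984PropagatorsII, (2.54) p.233] -/
theorem domBy_dist (b : L.B) : DomBy (toB6 (torusGeom Nf 0 0 0) 0 True) (L.dist b) :=
  fun a a' => L.tdist1_le_dist b a a'

/-- At the located pair the detour distance (3.93) is the range of the step. [cite: Balaban1985BackgroundPropagators, (3.93) p.410] -/
theorem dist_self (b : L.B) : L.dist b (L.x b) (L.y b) = tdist1 Nf (L.x b) (L.y b) := by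
  simp [dist, tdist1_self]

/-- The detour distance of a term starting or ending in `X` passes THROUGH `X`. [cite: Balaban1985BackgroundPropagators, (3.93) p.410] -/
theorem through_dist {X : Finset (UT Nf)} (b : L.B) (hb : L.x b ∈ X ∨ L.y b ∈ X) :
    Through (toB6 (torusGeom Nf 0 0 0) 0 True) (L.dist b) (↑X : Set (UT Nf)) := by
  intro a a'
  rcases hb with hx | hy
  · refine ⟨L.x b, Finset.mem_coe.2 hx, ?_⟩
    show tdist1 Nf a (L.x b) + tdist1 Nf (L.x b) a' ≤ L.dist b a a'
    have := tdist1_triangle (N := Nf) (L.x b) (L.y b) a'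
    unfold dist; linarith
  · refine ⟨L.y b, Finset.mem_coe.2 hy, ?_⟩
    show tdist1 Nf a (L.y b) + tdist1 Nf (L.y b) a' ≤ L.dist b a a'
    have := tdist1_triangle (N := Nf) a (L.x b) (L.y b)
    unfold dist; linarith

/-! ## §3. The per-term bound (3.108) for a one-step term -/

/-- The s-monomial on the polydisc `‖σ_j‖ ≤ e^{κ₁}` (`κ₁ ≥ 0`) is bounded by `e^{κ₁·m_J}` when `|J_b| ≤ m_J` — the factor
*"exp(mκ₁)"* of (1.11). [cite: Balaban1988RG2Cluster, (1.11) p.5] -/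
theorem norm_monomial_le {c : B13.Consts} (hκ₁ : 0 ≤ c.κ₁) {J : Finset (TPt d N')} {mJ : ℕ} (hJ : J.card ≤ mJ)
    (σ : TPt d N' → ℂ) (hσ : ∀ j, ‖σ j‖ ≤ Real.exp c.κ₁) :
    ‖∏ j ∈ J, σ j‖ ≤ Real.exp (c.κ₁ * mJ) := by
  rw [norm_prod]
  calc ∏ j ∈ J, ‖σ j‖ ≤ ∏ _j ∈ J, Real.exp c.κ₁ := Finset.prod_le_prod (fun j _ => norm_nonneg _) fun j _ => hσ j
    _ = Real.exp c.κ₁ ^ J.card := Finset.prod_const _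
    _ ≤ Real.exp c.κ₁ ^ mJ := pow_le_pow_right₀ (Real.one_le_exp hκ₁) hJ
    _ = Real.exp (c.κ₁ * mJ) := by rw [← Real.exp_nat_mul, mul_comm]

variable {L}
variable {c : B13.Consts} {locp : p → UT Nf} {locn : n → UT Nf} {X : Finset (UT Nf)} {R lam r : ℝ} {mJ nB : ℕ}

/-- **THE PER-TERM BOUND (3.108) ∕ (1.11) of a one-step term**, uniformly on polydisc × ball: `‖T_b(σ,u)(i,j)‖ ≤
λe^{κ₁m_J}e^{ρr}·e^{−ρD_b(loc i, loc j)}` (`ρ ≥ 0`): on the support the detour distance is the range `≤ r`, off the support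
the entry vanishes. [cite: Balaban1985BackgroundPropagators, (3.108) p.416; Balaban1988RG2Cluster, (1.11) p.5] -/
theorem norm_term_le (hL : L.IsLocal c locp locn X R lam r mJ nB) (hκ₁ : 0 ≤ c.κ₁) (hlam : 0 ≤ lam) {ρ : ℝ}
    (hρ : 0 ≤ ρ) (b : L.B) (σ : TPt d N' → ℂ) (hσ : ∀ j, ‖σ j‖ ≤ Real.exp c.κ₁) (u : E) (hu : u ∈ ball (0 : E) R)
    (i : p) (j : n) :
    ‖L.term b σ u i j‖ ≤ (lam * Real.exp (c.κ₁ * mJ) * Real.exp (ρ * r)) * Real.exp (-(ρ * L.dist b (locp i) (locn j))) := by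
  by_cases hM : L.M b i j = 0
  · rw [term_apply, hM, mul_zero, norm_zero]; positivity
  · obtain ⟨hi, hj⟩ := hL.hMsupp b i j hM
    rw [hi, hj, L.dist_self b, term_apply, norm_mul, norm_mul]
    have h1 := norm_monomial_le hκ₁ (hL.hJ b) σ hσ
    have h2 := hL.hcoef_bd b u hu
    have h3 := hL.hMle b i j
    have h4 : Real.exp (ρ * r) * Real.exp (-(ρ * tdist1 Nf (L.x b) (L.y b))) ≥ 1 := by
      rw [ge_iff_le, ← Real.exp_add]
      exact Real.one_le_exp (by nlinarith [mul_nonneg hρ (sub_nonneg.2 (hL.hrange b))])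
    calc ‖∏ j ∈ L.J b, σ j‖ * ‖L.coef b u‖ * ‖L.M b i j‖
        ≤ Real.exp (c.κ₁ * mJ) * lam * 1 :=
          mul_le_mul (mul_le_mul h1 h2 (norm_nonneg _) (Real.exp_nonneg _)) h3 (norm_nonneg _)
            (mul_nonneg (Real.exp_nonneg _) hlam)
      _ = (lam * Real.exp (c.κ₁ * mJ)) * 1 := by ring
      _ ≤ (lam * Real.exp (c.κ₁ * mJ)) * (Real.exp (ρ * r) * Real.exp (-(ρ * tdist1 Nf (L.x b) (L.y b)))) :=
          mul_le_mul_of_nonneg_left h4 (mul_nonneg hlam (Real.exp_nonneg _))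
      _ = (lam * Real.exp (c.κ₁ * mJ) * Real.exp (ρ * r)) * Real.exp (-(ρ * tdist1 Nf (L.x b) (L.y b))) := by ring

/-! ## §4. Summability without walk counting: the one row sum -/

/-- Fibre multiplicity: a non-negative function of the start site summed over the terms is at most `n_B` times its sum
over the sites. [folklore] -/
private theorem sum_start_le_mul_sum (hmult : ∀ z : UT Nf, (Finset.univ.filter fun b => L.x b = z).card ≤ nB)
    (f : UT Nf → ℝ) (hf : ∀ z, 0 ≤ f z) : ∑ b, f (L.x b) ≤ nB * ∑ z : UT Nf, f z := by
  classical
  rw [← Finset.sum_fiberwise_of_maps_to (g := L.x) (t := Finset.univ) (fun b _ => Finset.mem_univ _), Finset.mul_sum]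
  refine Finset.sum_le_sum fun z _ => ?_
  rw [Finset.sum_congr rfl fun b hb => by rw [(Finset.mem_filter.1 hb).2], Finset.sum_const, nsmul_eq_mul]
  exact mul_le_mul_of_nonneg_right (by exact_mod_cast hmult z) (hf z)

/-- **`MajSumLe` FOR THE ONE-STEP FAMILY, TORUS-UNIFORMLY**: `A ≥ 0`, `κ, μ ≥ 0`, `κ + μ ≤ ρ′`, (2.61) at rate `μ`
(constant `c_μ`) ⟹ every partial sum of `A·e^{−ρ′D_b(a,a′)}` over terms is `≤ (A·n_B·c_μ)e^{−κd₁(a,a′)}`: the detour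
distance pays `κd₁(a,a′)` AND `μd₁(a,x_b)`, the start sites are summed by (2.61) ([B9] p. 410 *"We use part of the
exponentials to control the sum over yᵢ's"*). [cite: Balaban1985BackgroundPropagators, (3.93)–(3.94) p.410, (3.108) p.416; Balaban1984PropagatorsII, (2.61) p.234] -/
theorem majSumLe_local (hmult : ∀ z : UT Nf, (Finset.univ.filter fun b => L.x b = z).card ≤ nB)
    {A ρ' κ μ cμ : ℝ} (hA : 0 ≤ A) (hκ : 0 ≤ κ) (hμ : 0 ≤ μ) (hwin : κ + μ ≤ ρ')
    (hrow : RowSum (toB6 (torusGeom Nf 0 0 0) 0 True) μ cμ) :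
    MajSumLe (g := toB6 (torusGeom Nf 0 0 0) 0 True)
      (fun b a a' => A * Real.exp (-(ρ' * L.dist b a a'))) (fun a a' => (A * (nB * cμ)) * Real.exp (-(κ * tdist1 Nf a a'))) := by
  intro S a a'
  -- termwise: e^{−ρ′D_b(a,a′)} ≤ e^{−κd₁(a,a′)}·e^{−μd₁(a,x_b)}
  have hterm : ∀ b, A * Real.exp (-(ρ' * L.dist b a a')) ≤
      (A * Real.exp (-(κ * tdist1 Nf a a'))) * Real.exp (-(μ * tdist1 Nf a (L.x b))) := by
    intro b
    rw [mul_assoc, ← Real.exp_add]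
    refine mul_le_mul_of_nonneg_left (Real.exp_le_exp.2 ?_) hA
    have h1 := L.tdist1_le_dist b a a'
    have h2 := L.tdist1_start_le_dist b a a'
    have h3 := L.dist_nonneg b a a'
    nlinarith [mul_nonneg hκ (sub_nonneg.2 h1), mul_nonneg hμ (sub_nonneg.2 h2),
      mul_nonneg (sub_nonneg.2 hwin) h3]
  have hrow' : ∑ z : UT Nf, Real.exp (-(μ * tdist1 Nf a z)) ≤ cμ := hrow a
  calc ∑ b ∈ S, A * Real.exp (-(ρ' * L.dist b a a'))
      ≤ ∑ b ∈ S, (A * Real.exp (-(κ * tdist1 Nf a a'))) * Real.exp (-(μ * tdist1 Nf a (L.x b))) :=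
        Finset.sum_le_sum fun b _ => hterm b
    _ ≤ ∑ b, (A * Real.exp (-(κ * tdist1 Nf a a'))) * Real.exp (-(μ * tdist1 Nf a (L.x b))) :=
        Finset.sum_le_sum_of_subset_of_nonneg (Finset.subset_univ S) fun b _ _ =>
          mul_nonneg (mul_nonneg hA (Real.exp_nonneg _)) (Real.exp_nonneg _)
    _ = (A * Real.exp (-(κ * tdist1 Nf a a'))) * ∑ b, Real.exp (-(μ * tdist1 Nf a (L.x b))) := by rw [Finset.mul_sum]
    _ ≤ (A * Real.exp (-(κ * tdist1 Nf a a'))) * (nB * ∑ z : UT Nf, Real.exp (-(μ * tdist1 Nf a z))) :=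
        mul_le_mul_of_nonneg_left (sum_start_le_mul_sum hmult (fun z => Real.exp (-(μ * tdist1 Nf a z)))
          fun z => Real.exp_nonneg _) (mul_nonneg hA (Real.exp_nonneg _))
    _ ≤ (A * Real.exp (-(κ * tdist1 Nf a a'))) * (nB * cμ) :=
        mul_le_mul_of_nonneg_left (mul_le_mul_of_nonneg_left hrow' (Nat.cast_nonneg nB))
          (mul_nonneg hA (Real.exp_nonneg _))
    _ = (A * (nB * cμ)) * Real.exp (-(κ * tdist1 Nf a a')) := by ring

/-! ## §5. The theorem: a local term datum IS a joint walk expansion, torus-uniformly -/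

/-- **ONE-STEP LOCAL KERNEL FAMILIES ARE JOINT WALK EXPANSIONS WITH TORUS-UNIFORM CONSTANTS.**  For a local datum
(`IsLocal`, `λ ≥ 0`, `κ₁ ≥ 0`), any `ρ ≥ 0`, drop `ε`, torus rate `κ ≥ 0`, row-sum rate `μ ≥ 0` with `κ + μ ≤ ρ − ε` and
(2.61) at rate `μ` (constant `c_μ`): `K = Σ_b T_b` is a `JointWalkExpansion` on the `R`-ball with terms `T_b`, σ-carrying
sub-family `{J_b ≠ ∅}`, amplitudes `A = λe^{κ₁m_J}e^{ρr}`, detour distances `D_b`, rate `ρ`, constant `K̄ = A·n_B·c_μ` —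
every letter independent of the torus `Nf` and of the index types (`hasSum` finite sum; `termAnalytic` const ×
differentiable × const; `maj` = `norm_term_le`; `majSum` = `majSumLe_local`; `indep` empty monomial; `through_dist`).
[cite: Balaban1985BackgroundPropagators, Thm 3.10 (3.107)–(3.108) p.416, (3.93) p.410; Balaban1988RG2Cluster, (1.11) p.5, p.13, p.15; Balaban1984PropagatorsII, (2.61) p.234] -/
theorem jointWalkExpansion_local (hL : L.IsLocal c locp locn X R lam r mJ nB) (hκ₁ : 0 ≤ c.κ₁) (hlam : 0 ≤ lam)
    {ρ ε κ μ cμ : ℝ} (hρ : 0 ≤ ρ) (hκ : 0 ≤ κ) (hμ : 0 ≤ μ) (hwin : κ + μ ≤ ρ - ε)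
    (hrow : RowSum (toB6 (torusGeom Nf 0 0 0) 0 True) μ cμ) :
    JointWalkExpansion c locp locn L.kernel X R ε κ
      ((lam * Real.exp (c.κ₁ * mJ) * Real.exp (ρ * r)) * (nB * cμ))
      L.term L.sigmaCarrying (fun _ => lam * Real.exp (c.κ₁ * mJ) * Real.exp (ρ * r)) L.dist ρ where
  hasSum σ hσ u hu i j := by
    rw [kernel_apply]
    exact hasSum_fintype _
  termAnalytic b σ hσ i j := by
    have h : (fun u => L.term b σ u i j) = fun u => (∏ j ∈ L.J b, σ j) * L.coef b u * L.M b i j :=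
      funext fun u => L.term_apply b σ u i j
    rw [h]
    exact ((differentiableOn_const _).mul (hL.hcoef_an b)).mul (differentiableOn_const _)
  maj b σ hσ u hu i j := norm_term_le hL hκ₁ hlam hρ b σ hσ u hu i j
  majSum := majSumLe_local hL.hmult (by positivity) hκ hμ hwin hrow
  indep b hb σ hσ := by
    have hJ : L.J b = ∅ := Finset.not_nonempty_iff_eq_empty.1 hb
    simp [term, hJ]
  through b hb := L.through_dist b (hL.hX b hb)
  A_nonneg _ := by positivity
  D_nonneg b a a' := L.dist_nonneg b a a'

end LocalTerms

/-- **(2.61) ON THE ONE-SCALE TORUS, EVERY SIZE**: the row sum at rate `μ > 0` holds with the constant `c₀(1,μ)^ν`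
([B6] Lemma 2.1 at one scale, `B9Thm37GlueTorus.torusSum_tdist1_le` at `δ₀ = 1`). [cite: Balaban1984PropagatorsII, Lemma 2.1 (2.61) p.234] -/
theorem rowSum_torus (Nf : Fin ν → ℕ) [∀ i, NeZero (Nf i)] {μ : ℝ} (hμ : 0 < μ) :
    RowSum (toB6 (torusGeom Nf 0 0 0) 0 True) μ (B6.c0 1 μ ^ ν) := by
  intro a
  show ∑ z : UT Nf, Real.exp (-(μ * tdist1 Nf a z)) ≤ _
  have h := torusSum_tdist1_le (N := Nf) a (δ₀ := 1) (α := μ) (by simpa using hμ)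
  simpa using h

/-- The same with the DIMENSION-MONOTONE constant `c₀(1,μ)^{d_m}` for every torus of dimension `ν ≤ d_m` (`c₀ ≥ 1`,
`B6Lemma21Arith.one_le_c0`): ONE row-sum constant for an exhausting family of tori. [cite: Balaban1984PropagatorsII, Lemma 2.1 (2.61) p.234] -/
theorem rowSum_torus_of_le (Nf : Fin ν → ℕ) [∀ i, NeZero (Nf i)] {μ : ℝ} (hμ : 0 < μ) {dm : ℕ} (hν : ν ≤ dm) :
    RowSum (toB6 (torusGeom Nf 0 0 0) 0 True) μ (B6.c0 1 μ ^ dm) := fun a =>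
  (rowSum_torus Nf hμ a).trans (pow_le_pow_right₀ (B6Lemma21Arith.one_le_c0 (by simpa using hμ)) hν)

namespace LocalTerms

variable {L : LocalTerms d N' ν Nf p n E}
variable {c : B13.Consts} {locp : p → UT Nf} {locn : n → UT Nf} {X : Finset (UT Nf)} {R lam r : ℝ} {mJ nB : ℕ}

/-- **The same with the row sum DISCHARGED for every torus size** (`rowSum_torus`): for `μ > 0` the constant
`K̄ = λe^{κ₁m_J}e^{ρr}·n_B·c₀(1,μ)^ν` serves EVERY torus `Nf` — the torus-independence that [B9] Thm 3.10 prints as *"The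
constant O(1) depends on d and L only"*. [cite: Balaban1985BackgroundPropagators, Thm 3.10 p.416; Balaban1984PropagatorsII, Lemma 2.1 (2.61) p.234] -/
theorem jointWalkExpansion_local_c0 (hL : L.IsLocal c locp locn X R lam r mJ nB) (hκ₁ : 0 ≤ c.κ₁) (hlam : 0 ≤ lam)
    {ρ ε κ μ : ℝ} (hρ : 0 ≤ ρ) (hκ : 0 ≤ κ) (hμ : 0 < μ) (hwin : κ + μ ≤ ρ - ε) :
    JointWalkExpansion c locp locn L.kernel X R ε κ
      ((lam * Real.exp (c.κ₁ * mJ) * Real.exp (ρ * r)) * (nB * B6.c0 1 μ ^ ν))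
      L.term L.sigmaCarrying (fun _ => lam * Real.exp (c.κ₁ * mJ) * Real.exp (ρ * r)) L.dist ρ :=
  jointWalkExpansion_local hL hκ₁ hlam hρ hκ hμ.le hwin (rowSum_torus Nf hμ)

/-- **The covariance-slot triple** (`WalkMajorants`: expansion + per-term bounds + FULL-rate majorants) for a local
datum — no analyticity used (`ε = 0`). [cite: Balaban1985BackgroundPropagators, (3.108) p.416] -/
theorem walkMajorants_local (hL : L.IsLocal c locp locn X R lam r mJ nB) (hκ₁ : 0 ≤ c.κ₁) (hlam : 0 ≤ lam)
    {ρ κ μ cμ : ℝ} (hρ : 0 ≤ ρ) (hκ : 0 ≤ κ) (hμ : 0 ≤ μ) (hwin : κ + μ ≤ ρ)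
    (hrow : RowSum (toB6 (torusGeom Nf 0 0 0) 0 True) μ cμ) :
    WalkMajorants c locp locn L.kernel R κ ((lam * Real.exp (c.κ₁ * mJ) * Real.exp (ρ * r)) * (nB * cμ))
      L.term (fun _ => lam * Real.exp (c.κ₁ * mJ) * Real.exp (ρ * r)) L.dist ρ := by
  have h := jointWalkExpansion_local hL hκ₁ hlam (ε := 0) hρ hκ hμ (by simpa using hwin) hrow
  exact ⟨h.hasSum, h.maj, by simpa using h.majSum, h.A_nonneg⟩

end LocalTerms

/-! ## §6. Non-vacuity with GENUINE σ- and u-dependence: the nearest-neighbour s-decoupled hopping family -/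

section Example

variable (Nf)

/-- MODEL. The located NEAREST-NEIGHBOUR HOPPING datum on the site torus itself (rows = columns = sites, identity
locator): one term per (site `z`, direction `μ`), hopping `z → z + e_μ` with entry pattern the matrix unit, AFFINE
coefficient `u ↦ λ·(1 + ℓ(u))` for ONE bounded linear functional `ℓ` of the configuration (genuine analytic
`u`-dependence, non-zero reference value `λ` at `u = 0`), and the s-monomial `σ_{j₀}` on the terms starting in the
σ-region `X` (genuine σ-dependence AT the reference configuration), no monomial elsewhere.
[cite: Balaban1988RG2Cluster, (1.11) p.5, p.13] -/
def hopping (lam : ℂ) (ℓ : E →L[ℂ] ℂ) (X : Finset (UT Nf)) (j₀ : TPt d N') :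
    LocalTerms d N' ν Nf (UT Nf) (UT Nf) E where
  B := UT Nf × Fin ν
  x := fun b => b.1
  y := fun b => B5Leibniz121.up b.1 b.2
  J := fun b => if b.1 ∈ X then {j₀} else ∅
  coef := fun _ u => lam * (1 + ℓ u)
  M := fun b => Matrix.of fun i j => if i = b.1 ∧ j = B5Leibniz121.up b.1 b.2 then 1 else 0

variable {Nf}

/-- The hopping datum is LOCAL with range `1`, `m_J = 1`, `n_B = ν` terms per start site, coefficient bound
`‖λ‖·(1 + ‖ℓ‖R)` on the `R`-ball (normalise `‖ℓ‖R ≤ 1` to read it as `O(λ)`), σ-region `X`. [cite: Balaban1988RG2Cluster, (1.11) p.5, p.13, p.15] -/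
theorem hopping_isLocal (c : B13.Consts) (lam : ℂ) (ℓ : E →L[ℂ] ℂ) (X : Finset (UT Nf)) (j₀ : TPt d N') (R : ℝ) :
    (hopping Nf lam ℓ X j₀).IsLocal c id id X R (‖lam‖ * (1 + ‖ℓ‖ * R)) 1 1 ν where
  hMle b i j := by
    simp only [hopping, Matrix.of_apply]
    split_ifs <;> simp
  hMsupp b i j h := by
    by_cases hP : i = b.1 ∧ j = B5Leibniz121.up b.1 b.2
    · exact hP
    · exact (h (by simp [hopping, hP])).elim
  hcoef_an b := (differentiableOn_const _).mul (ℓ.differentiable.differentiableOn.const_add _)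
  hcoef_bd b u hu := by
    have hu' : ‖u‖ ≤ R := by simpa using (mem_ball_zero_iff.1 hu).le
    refine (norm_mul_le _ _).trans (mul_le_mul_of_nonneg_left ((norm_add_le _ _).trans ?_) (norm_nonneg _))
    have : ‖ℓ u‖ ≤ ‖ℓ‖ * R := (ℓ.le_opNorm u).trans (mul_le_mul_of_nonneg_left hu' (norm_nonneg _))
    rw [norm_one]; linarith
  hrange b := B9Thm37GlueTorus.tdist1_up_le (N := Nf) b.1 b.2
  hJ b := by
    simp only [hopping]
    split_ifs <;> simp
  hX b hb := by
    simp only [hopping] at hb ⊢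
    by_cases h : b.1 ∈ X
    · exact Or.inl h
    · simp [h] at hb
  hmult z := by
    classical
    simp only [hopping]
    calc (Finset.univ.filter fun b : UT Nf × Fin ν => b.1 = z).card
        ≤ (Finset.image (fun μ : Fin ν => (z, μ)) Finset.univ).card := by
          refine Finset.card_le_card fun b hb => ?_
          simp only [Finset.mem_filter, Finset.mem_univ, true_and] at hb
          exact Finset.mem_image.2 ⟨b.2, Finset.mem_univ _, by rw [← hb]⟩
      _ ≤ (Finset.univ : Finset (Fin ν)).card := Finset.card_image_le
      _ = ν := by simp

/-- **NON-VACUITY WITH CONTENT**: for every torus `Nf`, the s-decoupled nearest-neighbour hopping kernel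
`K(σ,u)(z, z+e_μ) = λ(1 + ℓ(u))·(σ_{j₀} if z ∈ X, else 1)` is a `JointWalkExpansion` on the `R`-ball with drop `ε`, torus
rate `κ`, and constant `K̄ = ‖λ‖(1 + ‖ℓ‖R)e^{κ₁}e^{ρ}·ν·c₀(1,μ)^ν` INDEPENDENT OF `Nf` (`κ + μ ≤ ρ − ε`, `μ > 0`) — unlike the
one-torus JUNK witness of `B13TermWalkDataOneTorus` (`K̄ ∝ e^{κ·diam T}`).  Nothing about Bałaban's kernels.
[cite: Balaban1985BackgroundPropagators, Thm 3.10 p.416; Balaban1988RG2Cluster, (1.11) p.5, p.13] -/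
theorem jointWalkExpansion_hopping (c : B13.Consts) (hκ₁ : 0 ≤ c.κ₁) (lam : ℂ) (ℓ : E →L[ℂ] ℂ) (X : Finset (UT Nf))
    (j₀ : TPt d N') {R ρ ε κ μ : ℝ} (hR : 0 ≤ R) (hρ : 0 ≤ ρ) (hκ : 0 ≤ κ) (hμ : 0 < μ) (hwin : κ + μ ≤ ρ - ε) :
    JointWalkExpansion c id id (hopping Nf lam ℓ X j₀).kernel X R ε κ
      (((‖lam‖ * (1 + ‖ℓ‖ * R)) * Real.exp (c.κ₁ * (1 : ℕ)) * Real.exp (ρ * 1)) * ((ν : ℕ) * B6.c0 1 μ ^ ν))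
      (hopping Nf lam ℓ X j₀).term (hopping Nf lam ℓ X j₀).sigmaCarrying
      (fun _ => (‖lam‖ * (1 + ‖ℓ‖ * R)) * Real.exp (c.κ₁ * (1 : ℕ)) * Real.exp (ρ * 1)) (hopping Nf lam ℓ X j₀).dist ρ :=
  LocalTerms.jointWalkExpansion_local_c0 (hopping_isLocal c lam ℓ X j₀ R) hκ₁ (by positivity) hρ hκ hμ hwin

end Example

end Literature.MathematicalPhysics.QuantumFieldTheory.Balaban1983to89.B13LocalKernelWalks

end
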